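/-
Copyright (c) 2026 the pub-hodgecm-mathlib formalisation cell (harness21).  Prover seat hodgecm-mathlib-F0P2-p09 (g0), re-dealt to L1
`stub_firstTermThetaPairing` (director s1969∕s1970); hLiu418 = `stmt-HodgeConjecture-24832`; I4-conv (F′-fact), the `hlaw` payer in the UNIT currency of ★ `hlaw_of_upper_mul`.
-/
import Summits.HodgeConjecture.HodgeConjecture.Theorems.K2LiuKlingenInnerSectionLocalLaw    -- ★ (p861809): `innerSectionLoc_upper_mul` (family-of-units currency)
import HarnessLib

/-!
# Crux `HLiu418`, I4-conv (F′-fact) — `K2LiuKlingenInnerSectionLocalLawUnits`: THE LOCAL BOREL LAW OF `J_v` IN THE `(L_v)ˣ` CURRENCY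
# (★ `innerSectionLoc_upper_mul` restated with ONE unit `U ∈ (Π_{w∣v} L_w)ˣ` — VERBATIM the binder `hJ` of ★ `K2LiuKlingenInnerSectionLocalCharacter.hlaw_of_upper_mul`)

Cell `hodgecm-mathlib`, crux item hLiu418 = `stmt-HodgeConjecture-24832`; squad K2 ∕ K2Liu (re-dealt hand F0P2-p09 (g0)); LEAD F0P6-plan (g14); desk K2Liu-p14 (g3).
THEOREMS ONLY (no `def`, no instance, no notation, no named-fact hypothesis, no `sorry`); lane `--supports stmt-HodgeConjecture-24832 --as helper`.

★ `K2LiuKlingenInnerSectionLocalLaw.innerSectionLoc_upper_mul` (F0P2-p09) reads the corner unit of an upper-triangular `b ∈ U(J₂)(L⁺_v)` as a FAMILY `u : Π_w (L_w)ˣ`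
and its Haar-scaling binder as `hνT : ∀ u, ν_T ∘ (· (u_w)_w)⁻¹ = m_T(u) · ν_T`; ★ `K2LiuKlingenInnerSectionLocalCharacter.hlaw_of_upper_mul` (F0P2-p10) and ★ (D2)
`K2LiuLocalRingHaarModulus.pi_map_mul_right_units` read it as ONE unit `U ∈ (L_v)ˣ = (Π_w L_w)ˣ` (`hJ : ∀ b g U, … → Jv (b g) = cΔ b · (m_T U).toReal · Jv g`,
`m_T : (L_v)ˣ → ℝ≥0∞`).  The two currencies differ by `MulEquiv.piUnits`; this file restates the payer in the unit currency so that E discharges `hJ` BY NAME: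
**`innerSectionLoc_upper_mul_units`** — same hypotheses as ★ `innerSectionLoc_upper_mul` but `(mT : (LocalRing L v)ˣ → ℝ≥0∞) (hνT : ∀ U, νT.map (· * ↑U) = mT U • νT)`, conclusion
`∀ b g U, (∀ w, (b_w)₁₀ = 0) → (∀ w, U_w = (b_w)₀₀) → J_v(b g) = cΔ b · (mT U).toReal · J_v(g)`. [MoeglinWaldspurger1995, II.1.7], [Tan1999, §2], [BorelJacquet1979, §4.1].
HONEST LABEL.  Count-neutral helper: `HC_CM` is proved only modulo the 7 printed citations (2 remaining named inputs: hLiu418 = `stmt-HodgeConjecture-24832`,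
h413 = `stmt-HodgeConjecture-24833`) until rung 0 closes; this file closes no socket by itself.

## Mathlib ∕ tree search
Tree ★: `K2LiuKlingenInnerSectionLocalLaw.innerSectionLoc_upper_mul`, ★ `K2LiuKlingenInnerSectionLocalCharacter.hlaw_of_upper_mul` (consumer shape), ★ `K2LiuLocalRingHaarModulus`
(`mT` payer).  Mathlib: `Units.ext`.  Dedup: `rg "upper_mul_units" Summits/` — none.
-/

set_option autoImplicit false
set_option linter.dupNamespace false -- the mandated namespace repeats `HodgeConjecture.HodgeConjecture`

noncomputable section

open scoped Matrix ENNReal NNReal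
open NumberField IsDedekindDomain MeasureTheory Measure Filter Set

namespace Summit.HodgeConjecture.HodgeConjecture.Cruxes.HLiu418.K2LiuKlingenInnerSectionLocalLawUnits

open Literature.NumberTheory.Automorphic Literature.NumberTheory.Automorphic.UnitaryGroup
open Literature.NumberTheory.GelbartRogawski1991 Literature.NumberTheory.GelbartRogawski1991.GRConstruction
open Summit.HodgeConjecture.HodgeConjecture.Cruxes.HLiu418.K2LiuDoubledUTwoTwoBorelFrame
open Summit.HodgeConjecture.HodgeConjecture.Cruxes.HLiu418.K2LiuKlingenParabolicDefs
open Summit.HodgeConjecture.HodgeConjecture.Cruxes.HLiu418.K2LiuKlingenInnerSectionLocalDefs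
open Summit.HodgeConjecture.HodgeConjecture.Cruxes.HLiu418.K2LiuKlingenInnerSectionLocalLaw

variable (L : Type) [Field L] [NumberField L] [IsCMField L] (v : HeightOneSpectrum (𝓞 (Fp L)))

set_option synthInstance.maxHeartbeats 200000 in -- instance paths on `LocalRing L v = Π_w L_w` (as ★ B and ★ `innerSectionLoc_upper_mul`)
/-- **THE LOCAL BOREL LAW OF `J_v`, UNIT CURRENCY** — ★ `innerSectionLoc_upper_mul` with the corner unit read as ONE `U ∈ (L_v)ˣ` and the Haar-scaling binder
`hνT : ∀ U, ν_T ∘ (· U)⁻¹ = m_T(U) · ν_T` (★ (D2) `pi_map_mul_right_units` pays it for `ν_T := Measure.pi μ`); conclusion = VERBATIM the binder `hJ` of ★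
`hlaw_of_upper_mul`. [cite: MoeglinWaldspurger1995, II.1.7] [cite: Tan1999, §2] [cite: BorelJacquet1979, §4.1] -/
theorem innerSectionLoc_upper_mul_units
    [MeasurableSpace ↥(skewLoc L v)] [BorelSpace ↥(skewLoc L v)] [MeasurableSpace (LocalRing L v)] [BorelSpace (LocalRing L v)]
    (νY : Measure ↥(skewLoc L v)) (νT : Measure (LocalRing L v)) [SFinite νY] [SFinite νT] [νY.IsAddLeftInvariant]
    (mT : (LocalRing L v)ˣ → ℝ≥0∞) (hνT : ∀ U : (LocalRing L v)ˣ, νT.map (fun t : LocalRing L v => t * (U : LocalRing L v)) = mT U • νT)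
    {N' : ℕ} {J' : Matrix (Fin N') (Fin N') L}
    (Ψv : UnitaryGroup.localPi L (IsCMField.complexConj L) 4 ((StdForm.antidiagonal 4).over L) v →* UnitaryGroup.localPi L (IsCMField.complexConj L) N' J' v)
    (fv : UnitaryGroup.localPi L (IsCMField.complexConj L) N' J' v → ℂ) (xv : UnitaryGroup.localPi L (IsCMField.complexConj L) N' J' v)
    (cΔ : UnitaryGroup.localPi L (IsCMField.complexConj L) 2 ((StdForm.antidiagonal 2).over L) v → ℂ)
    (hfP : ∀ b : UnitaryGroup.localPi L (IsCMField.complexConj L) 2 ((StdForm.antidiagonal 2).over L) v,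
      (∀ w : UnitaryGroup.PlacesOver L v,
        (((b : UnitaryGroup.LocalGLPi L 2 v) w : GL (Fin 2) (w.1.adicCompletion L)) : Matrix (Fin 2) (Fin 2) (w.1.adicCompletion L)) 1 0 = 0) →
      ∀ h, fv (Ψv (jLoc L 4 v (weylXi (LocalRing L v) (conjLocal L (IsCMField.complexConj L) v) *
          klingenLevi (LocalRing L v) (conjLocal L (IsCMField.complexConj L) v) (conjLocal_conjLocal_cm L v) 1 ((jLoc L 2 v).symm b) *
            (weylXi (LocalRing L v) (conjLocal L (IsCMField.complexConj L) v))⁻¹)) * h) = cΔ b * fv h)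
    (hfU : ∀ (z : LocalRing L v) (h : UnitaryGroup.localPi L (IsCMField.complexConj L) N' J' v),
      fv (Ψv (jLoc L 4 v (weylXi (LocalRing L v) (conjLocal L (IsCMField.complexConj L) v) *
          uPlus (LocalRing L v) (conjLocal L (IsCMField.complexConj L) v) (conjLocal_conjLocal_cm L v) z *
            (weylXi (LocalRing L v) (conjLocal L (IsCMField.complexConj L) v))⁻¹)) * h) = fv h)
    (b g : UnitaryGroup.localPi L (IsCMField.complexConj L) 2 ((StdForm.antidiagonal 2).over L) v) (U : (LocalRing L v)ˣ)
    (hb : ∀ w : UnitaryGroup.PlacesOver L v,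
      (((b : UnitaryGroup.LocalGLPi L 2 v) w : GL (Fin 2) (w.1.adicCompletion L)) : Matrix (Fin 2) (Fin 2) (w.1.adicCompletion L)) 1 0 = 0)
    (hU : ∀ w : UnitaryGroup.PlacesOver L v, (U : LocalRing L v) w =
      (((b : UnitaryGroup.LocalGLPi L 2 v) w : GL (Fin 2) (w.1.adicCompletion L)) : Matrix (Fin 2) (Fin 2) (w.1.adicCompletion L)) 0 0) :
    innerSectionLoc L v νY νT Ψv fv xv (b * g) = cΔ b * ((mT U).toReal : ℂ) * innerSectionLoc L v νY νT Ψv fv xv g := by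
  -- the family of local units `(U_w)_w` and its converse
  let u : ∀ w : UnitaryGroup.PlacesOver L v, (w.1.adicCompletion L)ˣ := fun w =>
    ⟨(U : LocalRing L v) w, ((U⁻¹ : (LocalRing L v)ˣ) : LocalRing L v) w, congrFun U.mul_inv w, congrFun U.inv_mul w⟩
  obtain ⟨toU, htoU⟩ : ∃ toU : (∀ w : UnitaryGroup.PlacesOver L v, (w.1.adicCompletion L)ˣ) → (LocalRing L v)ˣ,
      ∀ u', (toU u' : LocalRing L v) = fun w => (u' w : w.1.adicCompletion L) :=
    ⟨fun u' => ⟨fun w => (u' w : w.1.adicCompletion L), fun w => ((u' w)⁻¹ : (w.1.adicCompletion L)ˣ),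
      funext fun w => (u' w).mul_inv, funext fun w => (u' w).inv_mul⟩, fun u' => rfl⟩
  have htoUu : toU u = U := Units.ext (by rw [htoU])
  have key := innerSectionLoc_upper_mul L v νY νT (fun u' => mT (toU u')) (fun u' => by rw [← htoU u']; exact hνT (toU u'))
    Ψv fv xv cΔ hfP hfU b g hb u (fun w => hU w)
  rw [htoUu] at key
  exact key

end Summit.HodgeConjecture.HodgeConjecture.Cruxes.HLiu418.K2LiuKlingenInnerSectionLocalLawUnits

end
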